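import Literature.Geometry.Symplectic.PencilEndAlmostComplex
import HarnessLib

/-!
# The compactified pencil member as an embedded `JY`-sphere of the blown-up end

Topic `Literature/Geometry/Symplectic` (infrastructure for
`Literature.Geometry.Symplectic.jPlanePencil_localFamily_homotopySphere`, Wendl LNM 2216, proof of
Prop. 2.53, p. 65: "blow up at the constraint points to reduce `m = 1` to `m = 0`").

In the glued manifold `Y = (M ∖ p) ∪_ψ Ω` of `PencilEndGluing.lean` (blown-up coordinates
`(x', w) = (1/z, w)` on the box `Ω`), with its almost complex structure `JY`
(`PencilEndAlmostComplex.lean`), a member `u` of Gromov's pencil of `J`-planes with intercept `b`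
(`IsPencilPlane J u b`, `‖b − b₀‖ < ρ'`) closes up to a TWO-CHART SPHERE

  `U ξ = inP (u ξ)`,   `V η = inP (u η⁻¹)` (`η ≠ 0`),   `V 0 = inB (0, b)`,

the point `(0, b)` of the exceptional disc `E = {x' = 0}` being the limit of
`(x', w)(u η⁻¹) = (1/z, w) → (0, b)`. We prove that `(U, V)` satisfies the nine sphere hypotheses
of the local-foliation fact `hls_localFoliation_embeddedSphere_trivialNormal` in `(Y, JY)`:
both charts are `C^∞` and `JY`-holomorphic, `V η = U η⁻¹` off `0`, `U` is injective and immersed,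
`V` is immersed at `0`, and `V 0 ∉ range U`.

* `memberW p u b`, `memberXW p u b` — the box coordinates `(x', w)` of `u η⁻¹` as functions of
  `η`, extended by `(0, b)` at `η = 0`; complex differentiable on a disc about `0`
  (`IsPencilPlane.exists_differentiableOn_memberXW`: removable singularity, from
  `IsPencilPlane.exists_differentiableOn_compactification` and
  `IsPencilPlane.analyticAt_snd_pencilCoord_inv`).
* `PencilEnd.boxPt`, `PencilEnd.inBox` — the point of `Y` with given box coordinates.
* `PencilEnd.memberU`, `PencilEnd.memberV` — the two charts; `memberV_eventuallyEq` (near `0`,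
  `V = inBox ∘ memberXW`), `contMDiff_memberU/V`, `isJHolomorphic_memberU/V`,
  `injective_memberU`, `injective_mfderiv_memberU/V`, `memberV_zero_notMem_range`.

## References

* C. Wendl, *Holomorphic Curves in Low Dimensions*, LNM 2216 (2018), proof of Prop. 2.53, p. 65.
  [Wendl2018]
* M. Gromov, *Pseudo holomorphic curves in symplectic manifolds*, Invent. Math. 82 (1985), 2.4.A′.
  [Gromov1985]
-/

noncomputable section

open scoped Manifold ContDiff Topology
open Set Function Metric Filter Literature.Topology.FourManifolds

namespace Literature.Geometry.Symplectic

/-! ### The box coordinates of a member near infinity -/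

section MemberXW

variable {M : Type*} [TopologicalSpace M] [T2Space M] [ChartedSpace (EuclideanSpace ℝ (Fin 4)) M]

/-- The `w`-coordinate of `u (η⁻¹)`, extended by the intercept `b` at `η = 0`.
[cite: Wendl2018, proof of Prop. 2.53 (p. 65)] -/
def memberW (p : M) (u : ℂ → punctured p) (b : ℂ) (η : ℂ) : ℂ :=
  if η = 0 then b else (pencilCoord p (u η⁻¹)).2

/-- The blown-up (box) coordinates `(x', w) = (1/z, w)` of `u (η⁻¹)`, extended by `(0, b)` at
`η = 0`. [cite: Wendl2018, proof of Prop. 2.53 (p. 65)] -/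
def memberXW (p : M) (u : ℂ → punctured p) (b : ℂ) (η : ℂ) : ℂ × ℂ :=
  (capX p u η, memberW p u b η)

variable {p : M} {u : ℂ → punctured p} {b : ℂ}

/-- `memberW` at `0` is the intercept. [folklore] -/
@[simp] theorem memberW_zero : memberW p u b 0 = b := by simp [memberW]

/-- `memberW` off `0`. [folklore] -/
theorem memberW_of_ne_zero {η : ℂ} (hη : η ≠ 0) : memberW p u b η = (pencilCoord p (u η⁻¹)).2 := by
  simp [memberW, hη]

/-- `memberW` is the `update` at `0` of `η ↦ w (u η⁻¹)`. [folklore] -/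
theorem memberW_eq_update :
    memberW p u b = update (fun η : ℂ => (pencilCoord p (u η⁻¹)).2) 0 b := by
  funext η
  rcases eq_or_ne η 0 with rfl | hη
  · simp
  · rw [memberW_of_ne_zero hη, update_of_ne hη]

/-- `memberXW` at `0` is the point `(0, b)` of the exceptional disc. [folklore] -/
@[simp] theorem memberXW_zero : memberXW p u b 0 = (0, b) := by
  simp [memberXW]

/-- Off `0`, `memberXW η = blowDown (pencilCoord (u η⁻¹)) = (1/z, w)`. [folklore] -/
theorem memberXW_of_ne_zero {η : ℂ} (hη : η ≠ 0) :
    memberXW p u b η = blowDown (pencilCoord p (u η⁻¹)) := by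
  simp [memberXW, memberW_of_ne_zero hη, capX_of_ne_zero hη, blowDown]

end MemberXW

section MemberXWAnalytic

variable {M : Type*} [TopologicalSpace M] [T2Space M] [CompactSpace M]
  [ChartedSpace (EuclideanSpace ℝ (Fin 4)) M] [IsManifold (𝓡 4) ∞ M]
  {p : M} {J : ∀ x : punctured p, TangentSpace (𝓡 4) x →L[ℝ] TangentSpace (𝓡 4) x}
  {u : ℂ → punctured p} {b : ℂ} {ε : ℝ}

/-- **Removable singularity in the box coordinates.** For a member `u` of intercept `b` (with `J`
standard on the punctured `ε`-chart-ball), `memberXW p u b` is complex differentiable on a disc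
about `0`. [cite: Wendl2018, proof of Prop. 2.53 (p. 65)] -/
theorem IsPencilPlane.exists_differentiableOn_memberXW (h : IsPencilPlane J u b) (hε : 0 < ε)
    (hJstd : ∀ x : punctured p, InPuncturedChartBall p ε x →
      ∀ (v : TangentSpace (𝓡 4) x) (c : EuclideanSpace ℝ (Fin 4)),
        inner ℝ (fderiv ℝ inversion (extChartAt (𝓡 4) p x.1 - extChartAt (𝓡 4) p p)
          (mfderiv (𝓡 4) 𝓘(ℝ, EuclideanSpace ℝ (Fin 4))
            (fun z : punctured p => extChartAt (𝓡 4) p z.1) x (J x v))) c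
        = stdSymplecticForm (fderiv ℝ inversion (extChartAt (𝓡 4) p x.1 - extChartAt (𝓡 4) p p)
          (mfderiv (𝓡 4) 𝓘(ℝ, EuclideanSpace ℝ (Fin 4))
            (fun z : punctured p => extChartAt (𝓡 4) p z.1) x v)) c) :
    ∃ r : ℝ, 0 < r ∧ DifferentiableOn ℂ (memberXW p u b) (ball 0 r) := by
  obtain ⟨r₁, hr₁, hX, -⟩ := h.exists_differentiableOn_compactification hε hJstd
  obtain ⟨R, hR, -⟩ := h.exists_differentiableOn_pencilCoord hε hJstd
  have hW0 : DifferentiableAt ℂ (memberW p u b) 0 := by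
    rw [memberW_eq_update]
    exact (h.analyticAt_snd_pencilCoord_inv hε hJstd).differentiableAt
  set T : ℝ := max R 1 with hT
  have hTpos : 0 < T := lt_of_lt_of_le one_pos (le_max_right _ _)
  refine ⟨min r₁ T⁻¹, lt_min hr₁ (inv_pos.2 hTpos), fun η hη => ?_⟩
  rw [mem_ball, dist_zero_right, lt_min_iff] at hη
  refine DifferentiableAt.differentiableWithinAt (DifferentiableAt.prodMk ?_ ?_)
  · rw [← capX_eq] at hX
    exact hX.differentiableAt (isOpen_ball.mem_nhds (by simpa using hη.1))
  · rcases eq_or_ne η 0 with rfl | hη0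
    · exact hW0
    · have hηinv : T < ‖η⁻¹‖ := by
        rw [norm_inv, lt_inv_comm₀ hTpos (norm_pos_iff.2 hη0)]; exact hη.2
      have hd : DifferentiableAt ℂ (fun ζ => pencilCoord p (u ζ)) η⁻¹ :=
        hR _ ((le_max_left _ _).trans hηinv.le)
      have hcomp : DifferentiableAt ℂ (fun η' : ℂ => (pencilCoord p (u η'⁻¹)).2) η :=
        (hd.comp η (differentiableAt_inv hη0)).snd
      refine hcomp.congr_of_eventuallyEq ?_
      filter_upwards [isOpen_compl_singleton.mem_nhds hη0] with θ hθ
      exact memberW_of_ne_zero hθ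

end MemberXWAnalytic

/-! ### Two real-linear maps: the derivative of inversion, and of the box coordinates at `0` -/

section LinearMaps

variable {M : Type*} [TopologicalSpace M] [T2Space M] [ChartedSpace (EuclideanSpace ℝ (Fin 4)) M]
  {p : M} {J : ∀ x : punctured p, TangentSpace (𝓡 4) x →L[ℝ] TangentSpace (𝓡 4) x}
  {u : ℂ → punctured p} {b : ℂ}

/-- **`x'` has derivative `1` at the point at infinity** (`X = 1/z(u(1/η))`, `X'(0) = 1`).
[cite: Wendl2018, Prop. 2.53 (1) (m = 1)] -/
theorem IsPencilPlane.hasDerivAt_capX_zero (h : IsPencilPlane J u b) : HasDerivAt (capX p u) 1 0 := by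
  rw [capX_eq]; exact h.hasDerivAt_inv_fst_zero

/-- The real-linear derivative `ζ ↦ -ζ/η²` of `η ↦ η⁻¹` at `η ≠ 0`. [folklore] -/
def invDeriv (η : ℂ) : ℂ →L[ℝ] ℂ :=
  (ContinuousLinearMap.smulRight (1 : ℂ →L[ℂ] ℂ) (-(η ^ 2)⁻¹)).restrictScalars ℝ

/-- Values of `invDeriv`. [folklore] -/
@[simp] theorem invDeriv_apply (η ζ : ℂ) : invDeriv η ζ = -(ζ * (η ^ 2)⁻¹) := by
  simp [invDeriv]

/-- `invDeriv` is complex-linear. [folklore] -/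
theorem invDeriv_I_mul (η ζ : ℂ) : invDeriv η (Complex.I * ζ) = Complex.I * invDeriv η ζ := by
  rw [invDeriv_apply, invDeriv_apply]; ring

/-- `invDeriv` is the derivative of inversion. [folklore] -/
theorem hasMFDerivAt_inv' {η : ℂ} (hη : η ≠ 0) :
    HasMFDerivAt 𝓘(ℝ, ℂ) 𝓘(ℝ, ℂ) (fun η' : ℂ => η'⁻¹) η (invDeriv η) :=
  ((hasDerivAt_inv hη).hasFDerivAt.restrictScalars ℝ).hasMFDerivAt

/-- `invDeriv η` is injective for `η ≠ 0`. [folklore] -/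
theorem injective_invDeriv {η : ℂ} (hη : η ≠ 0) : Injective (invDeriv η) := by
  intro v₁ v₂ hv
  have hc : ((η ^ 2)⁻¹ : ℂ) ≠ 0 := inv_ne_zero (pow_ne_zero 2 hη)
  rw [invDeriv_apply, invDeriv_apply, neg_inj] at hv
  exact mul_right_cancel₀ hc hv

/-- The derivative of the box coordinates at `0`: first component `ζ ↦ ζ` (`X'(0) = 1`), second the
complex derivative of `memberW`; a complex-linear map. [folklore] -/
def memberXWDeriv (u : ℂ → punctured p) (b : ℂ) : ℂ →L[ℝ] ℂ × ℂ :=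
  ((ContinuousLinearMap.smulRight (1 : ℂ →L[ℂ] ℂ) (1 : ℂ)).restrictScalars ℝ).prod
    ((fderiv ℂ (memberW p u b) 0).restrictScalars ℝ)

/-- First component of `memberXWDeriv`. [folklore] -/
@[simp] theorem memberXWDeriv_apply_fst (ζ : ℂ) : (memberXWDeriv u b ζ).1 = ζ := by
  simp [memberXWDeriv]

/-- `memberXWDeriv` is complex-linear. [folklore] -/
theorem memberXWDeriv_smul (c ζ : ℂ) : memberXWDeriv u b (c • ζ) = c • memberXWDeriv u b ζ :=
  Prod.ext (by simp [memberXWDeriv]) (by simp [memberXWDeriv, mul_assoc])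

/-- `memberXWDeriv` is injective (its first component is the identity). [folklore] -/
theorem injective_memberXWDeriv : Injective (memberXWDeriv u b) := by
  intro v₁ v₂ hv
  have := congrArg Prod.fst hv
  rwa [memberXWDeriv_apply_fst, memberXWDeriv_apply_fst] at this

/-- **The box coordinates have derivative `memberXWDeriv` at `0`** (when they are complex
differentiable on a disc about `0`). [folklore] -/
theorem IsPencilPlane.hasFDerivAt_memberXW (hu : IsPencilPlane J u b) {r : ℝ} (hr : 0 < r)
    (hdiff : DifferentiableOn ℂ (memberXW p u b) (ball 0 r)) :
    HasFDerivAt (memberXW p u b) (memberXWDeriv u b) 0 := by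
  have hX : HasFDerivAt (capX p u)
      ((ContinuousLinearMap.smulRight (1 : ℂ →L[ℂ] ℂ) (1 : ℂ)).restrictScalars ℝ) 0 :=
    hu.hasDerivAt_capX_zero.hasFDerivAt.restrictScalars ℝ
  have hW : DifferentiableAt ℂ (memberW p u b) 0 :=
    (hdiff.differentiableAt (ball_mem_nhds 0 hr)).snd
  have hW' : HasFDerivAt (memberW p u b) ((fderiv ℂ (memberW p u b) 0).restrictScalars ℝ) 0 :=
    hW.hasFDerivAt.restrictScalars ℝ
  exact hX.prodMk hW'

end LinearMaps

namespace PencilEnd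

variable {M : Type*} [TopologicalSpace M] [T2Space M] [ChartedSpace (EuclideanSpace ℝ (Fin 4)) M]
  [IsManifold (𝓡 4) ∞ M] {p : M} (G : PencilEnd p)

/-! ### Points of `Y` with given box coordinates -/

open Classical in
/-- The box point with coordinates `q` (junk `(0, b₀)` if `q ∉ Ω`). [folklore] -/
def boxPt (q : ℂ × ℂ) : G.box :=
  if h : q ∈ G.box then ⟨q, h⟩ else ⟨((0 : ℂ), G.b₀), G.zero_mem_box⟩

omit [T2Space M] [IsManifold (𝓡 4) ∞ M] in
/-- `boxPt` on box points. [folklore] -/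
theorem boxPt_of_mem {q : ℂ × ℂ} (hq : q ∈ G.box) : G.boxPt q = ⟨q, hq⟩ := by
  simp [boxPt, hq]

omit [T2Space M] [IsManifold (𝓡 4) ∞ M] in
/-- Coordinates of `boxPt q` for `q ∈ Ω`. [folklore] -/
@[simp] theorem coe_boxPt_of_mem {q : ℂ × ℂ} (hq : q ∈ G.box) : (G.boxPt q : ℂ × ℂ) = q := by
  rw [G.boxPt_of_mem hq]

/-- The point of `Y` with box coordinates `q` (junk off the box). [folklore] -/
def inBox (q : ℂ × ℂ) : G.Y := G.inB (G.boxPt q)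

/-- `inBox q = inB ⟨q, _⟩` on the box. [folklore] -/
theorem inBox_of_mem {q : ℂ × ℂ} (hq : q ∈ G.box) : G.inBox q = G.inB ⟨q, hq⟩ := by
  rw [inBox, G.boxPt_of_mem hq]

/-- A point of the gluing region, seen through its box coordinates. [folklore] -/
theorem inP_eq_inBox {c : punctured p} (hc : c ∈ G.src) :
    G.inP c = G.inBox (blowDown (pencilCoord p c)) := by
  rw [G.inP_eq_inB_glueFun hc, inBox]
  congr 1
  apply Subtype.ext
  rw [G.glueFun_of_mem hc, G.coe_boxPt_of_mem]
  · rfl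
  · exact G.glue_mem_box hc

/-! ### Calculus of box-valued maps -/

section BoxCalculus

variable {g : ℂ → ℂ × ℂ} {x : ℂ}

omit [T2Space M] [IsManifold (𝓡 4) ∞ M] in
/-- A map into the box is continuous at a point where its coordinates are, when they lie in the box
nearby. [folklore] -/
theorem continuousAt_boxPt_comp (hg : ContinuousAt g x) (hx : g x ∈ G.box) :
    ContinuousAt (fun y => G.boxPt (g y)) x := by
  rw [Topology.IsInducing.subtypeVal.continuousAt_iff]
  refine hg.congr ?_
  filter_upwards [hg.preimage_mem_nhds (G.box.isOpen.mem_nhds hx)] with y hy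
  exact (G.coe_boxPt_of_mem hy).symm

omit [T2Space M] [IsManifold (𝓡 4) ∞ M] in
/-- **Manifold derivative of a box-valued map** from the Fréchet derivative of its coordinates.
[folklore] -/
theorem hasMFDerivAt_boxPt_comp {g' : ℂ →L[ℝ] ℂ × ℂ} (hg : HasFDerivAt g g' x) (hx : g x ∈ G.box) :
    HasMFDerivAt 𝓘(ℝ, ℂ) 𝓘(ℝ, ℂ × ℂ) (fun y => G.boxPt (g y)) x g' := by
  refine ⟨G.continuousAt_boxPt_comp hg.continuousAt hx, ?_⟩
  have hev : writtenInExtChartAt 𝓘(ℝ, ℂ) 𝓘(ℝ, ℂ × ℂ) x (fun y => G.boxPt (g y)) =ᶠ[𝓝 x] g := by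
    filter_upwards [hg.continuousAt.preimage_mem_nhds (G.box.isOpen.mem_nhds hx)] with y hy
    simp only [writtenInExtChartAt, extChartAt_box_apply, comp_apply, extChartAt_model_space_eq_id,
      PartialEquiv.refl_coe, PartialEquiv.refl_symm, id]
    exact G.coe_boxPt_of_mem hy
  have h0 : extChartAt 𝓘(ℝ, ℂ) x x = x := rfl
  rw [h0]
  exact (hg.congr_of_eventuallyEq hev).hasFDerivWithinAt

omit [T2Space M] [IsManifold (𝓡 4) ∞ M] in
/-- **Smoothness of a box-valued map** from smoothness of its coordinates (on an open set mapped
into the box). [folklore] -/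
theorem contMDiffOn_boxPt_comp {s : Set ℂ} (hg : ContDiffOn ℝ ∞ g s)
    (hmaps : MapsTo g s G.box) :
    ContMDiffOn 𝓘(ℝ, ℂ) 𝓘(ℝ, ℂ × ℂ) ∞ (fun y => G.boxPt (g y)) s := by
  intro y hy
  rw [← ContMDiffWithinAt.subtypeVal_comp_iff]
  refine (hg.contMDiffOn y hy).congr (fun y' hy' => ?_) ?_
  · exact G.coe_boxPt_of_mem (hmaps hy')
  · exact G.coe_boxPt_of_mem (hmaps hy)

/-- **Smoothness of `inBox ∘ g`** on an open set where the coordinates `g` are smooth and lie in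
the box. [folklore] -/
theorem contMDiffOn_inBox_comp {s : Set ℂ} (hg : ContDiffOn ℝ ∞ g s) (hmaps : MapsTo g s G.box) :
    ContMDiffOn 𝓘(ℝ, ℂ) (𝓡 4) ∞ (fun y => G.inBox (g y)) s :=
  G.glueData.contMDiff_inr.comp_contMDiffOn (G.contMDiffOn_boxPt_comp hg hmaps)

/-- **Derivative of `inBox ∘ g` at a point sent to the exceptional disc**: `flatCx⁻¹ ∘ g'`.
[folklore] -/
theorem hasMFDerivAt_inBox_comp {g' : ℂ →L[ℝ] ℂ × ℂ} (hg : HasFDerivAt g g' x) (hx : g x ∈ G.box)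
    (h0 : (g x).1 = 0) :
    HasMFDerivAt 𝓘(ℝ, ℂ) (𝓡 4) (fun y => G.inBox (g y)) x
      ((flatCx.symm : ℂ × ℂ →L[ℝ] EuclideanSpace ℝ (Fin 4)).comp g') := by
  have h1 := G.hasMFDerivAt_boxPt_comp hg hx
  have h2 : HasMFDerivAt 𝓘(ℝ, ℂ × ℂ) (𝓡 4) G.inB (G.boxPt (g x))
      (flatCx.symm : ℂ × ℂ →L[ℝ] EuclideanSpace ℝ (Fin 4)) :=
    G.hasMFDerivAt_inB (by rw [G.coe_boxPt_of_mem hx]; exact h0)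
  exact h2.comp x h1

end BoxCalculus

/-! ### The two charts of the compactified member -/

/-- The `ℂ`-chart of the compactified member: `U ξ = inP (u ξ)`.
[cite: Wendl2018, proof of Prop. 2.53 (p. 65)] -/
def memberU (u : ℂ → punctured p) (ξ : ℂ) : G.Y := G.inP (u ξ)

open Classical in
/-- The chart at infinity of the compactified member: `V η = inP (u η⁻¹)` for `η ≠ 0` and
`V 0 = inB (0, b)`, the point of the exceptional disc with `w`-coordinate the intercept.
[cite: Wendl2018, proof of Prop. 2.53 (p. 65)] -/
def memberV (u : ℂ → punctured p) (b : ℂ) (η : ℂ) : G.Y :=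
  if η = 0 then G.inBox ((0 : ℂ), b) else G.inP (u η⁻¹)

variable {u : ℂ → punctured p} {b : ℂ}

/-- Unfolding of `memberU`. [folklore] -/
@[simp] theorem memberU_apply (ξ : ℂ) : G.memberU u ξ = G.inP (u ξ) := rfl

/-- `V 0 = inBox (0, b)`. [folklore] -/
@[simp] theorem memberV_zero : G.memberV u b 0 = G.inBox ((0 : ℂ), b) := by simp [memberV]

/-- `V η = inP (u η⁻¹)` for `η ≠ 0`. [folklore] -/
theorem memberV_of_ne_zero {η : ℂ} (hη : η ≠ 0) : G.memberV u b η = G.inP (u η⁻¹) := by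
  simp [memberV, hη]

/-- **The two charts agree off `0`**: `V η = U η⁻¹`. [folklore] -/
theorem memberV_eq_memberU_inv {η : ℂ} (hη : η ≠ 0) : G.memberV u b η = G.memberU u η⁻¹ := by
  rw [G.memberV_of_ne_zero hη, memberU_apply]

/-- Near any `η ≠ 0`, `V = inP ∘ u ∘ (·)⁻¹`. [folklore] -/
theorem memberV_eventuallyEq_of_ne_zero {η : ℂ} (hη : η ≠ 0) :
    G.memberV u b =ᶠ[𝓝 η] fun η' => G.inP (u η'⁻¹) := by
  filter_upwards [isOpen_compl_singleton.mem_nhds hη] with η' hη'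
  exact G.memberV_of_ne_zero hη'

omit [T2Space M] [IsManifold (𝓡 4) ∞ M] in
/-- `(0, b)` is a box point when `‖b − b₀‖ < ρ'`. [folklore] -/
theorem zero_intercept_mem_box (hb : ‖b - G.b₀‖ < G.ρ') : ((0 : ℂ), b) ∈ G.box := by
  rw [G.mem_box_iff]; exact ⟨by simp [G.ρ_pos], hb⟩

/-- `V 0` lies on the exceptional disc, hence not on the `ℂ`-chart. [folklore] -/
theorem memberV_zero_notMem_range (hb : ‖b - G.b₀‖ < G.ρ') :
    G.memberV u b 0 ∉ range (G.memberU u) := by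
  rintro ⟨ξ, hξ⟩
  rw [memberV_zero, memberU_apply, G.inBox_of_mem (G.zero_intercept_mem_box hb)] at hξ
  exact G.inB_notMem_range_inP (q := ⟨((0 : ℂ), b), G.zero_intercept_mem_box hb⟩) rfl ⟨u ξ, hξ⟩

/-! ### The compactified member: radius, smoothness, holomorphy, embedding -/

section Member

variable {J : ∀ x : punctured p, TangentSpace (𝓡 4) x →L[ℝ] TangentSpace (𝓡 4) x}

omit [IsManifold (𝓡 4) ∞ M] in
/-- **A radius for the chart at infinity**: for `0 < ‖η‖ < r` the point `u (η⁻¹)` lies in the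
gluing region (standard chart ball, `‖z‖ > 1/ρ`, `‖w − b₀‖ < ρ'`) and `‖z‖ > 1`.
[cite: Wendl2018, proof of Prop. 2.53 (p. 65)] -/
theorem exists_memberV_radius [CompactSpace M] (hu : IsPencilPlane J u b) (hb : ‖b - G.b₀‖ < G.ρ') :
    ∃ r : ℝ, 0 < r ∧ ∀ η : ℂ, η ≠ 0 → ‖η‖ < r → u η⁻¹ ∈ G.src ∧ 1 < ‖(pencilCoord p (u η⁻¹)).1‖ := by
  have h1 : ∀ᶠ ξ in cocompact ℂ, InPuncturedChartBall p G.rad (u ξ) :=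
    hu.eventually_inPuncturedChartBall G.rad_pos
  have h2 : ∀ᶠ ξ in cocompact ℂ, max G.ρ⁻¹ 1 < ‖(pencilCoord p (u ξ)).1‖ :=
    hu.tendsto_norm_fst.eventually_gt_atTop _
  have h3 : ∀ᶠ ξ in cocompact ℂ, ‖(pencilCoord p (u ξ)).2 - G.b₀‖ < G.ρ' := by
    have ht : Tendsto (fun ξ : ℂ => ‖(pencilCoord p (u ξ)).2 - G.b₀‖) (cocompact ℂ)
        (𝓝 ‖b - G.b₀‖) := (hu.tendsto_snd.sub_const G.b₀).norm
    exact ht.eventually (gt_mem_nhds hb)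
  obtain ⟨T, hT⟩ := exists_forall_norm_le_of_eventually_cocompact ((h1.and h2).and h3)
  set T' : ℝ := max T 1 with hT'
  have hT'pos : 0 < T' := lt_of_lt_of_le one_pos (le_max_right _ _)
  refine ⟨T'⁻¹, inv_pos.2 hT'pos, fun η hη0 hη => ?_⟩
  have hηinv : T' < ‖η⁻¹‖ := by
    rw [norm_inv]; rwa [lt_inv_comm₀ hT'pos (norm_pos_iff.2 hη0)]
  obtain ⟨⟨hball, hz⟩, hw⟩ := hT η⁻¹ ((le_max_left _ _).trans hηinv.le)
  exact ⟨⟨hball, (le_max_left _ _).trans_lt hz, hw⟩, (le_max_right _ _).trans_lt hz⟩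

/-- **Near `0` the chart at infinity is `inBox ∘ memberXW`.**
[cite: Wendl2018, proof of Prop. 2.53 (p. 65)] -/
theorem memberV_eventuallyEq [CompactSpace M] (hu : IsPencilPlane J u b) (hb : ‖b - G.b₀‖ < G.ρ') :
    G.memberV u b =ᶠ[𝓝 0] fun η => G.inBox (memberXW p u b η) := by
  obtain ⟨r, hr, hsrc⟩ := G.exists_memberV_radius hu hb
  filter_upwards [ball_mem_nhds (0 : ℂ) hr] with η hη
  rw [mem_ball, dist_zero_right] at hη
  rcases eq_or_ne η 0 with rfl | hη0
  · simp
  · rw [G.memberV_of_ne_zero hη0, G.inP_eq_inBox (hsrc η hη0 hη).1, memberXW_of_ne_zero hη0]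

/-- **The `ℂ`-chart of the compactified member is `C^∞`.** [folklore] -/
theorem contMDiff_memberU (hu : ContMDiff 𝓘(ℝ, ℂ) (𝓡 4) ∞ u) :
    ContMDiff 𝓘(ℝ, ℂ) (𝓡 4) ∞ (G.memberU u) :=
  G.glueData.contMDiff_inl.comp hu

/-- `inP ∘ u ∘ (·)⁻¹` is `C^∞` at every `η ≠ 0`. [folklore] -/
theorem contMDiffAt_inP_comp_inv (hu : ContMDiff 𝓘(ℝ, ℂ) (𝓡 4) ∞ u) {η : ℂ} (hη : η ≠ 0) :
    ContMDiffAt 𝓘(ℝ, ℂ) (𝓡 4) ∞ (fun η' => G.inP (u η'⁻¹)) η := by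
  have h1 : ContMDiffAt 𝓘(ℝ, ℂ) 𝓘(ℝ, ℂ) ∞ (fun η' : ℂ => η'⁻¹) η :=
    ((contDiffAt_inv ℂ hη).restrict_scalars ℝ).contMDiffAt
  exact (G.contMDiff_memberU hu).contMDiffAt.comp η h1

/-- A box-coordinate disc for the chart at infinity: `memberXW` is complex differentiable on
`B_r(0)` and maps it into the box, and `V = inBox ∘ memberXW` there. [folklore] -/
theorem exists_memberXW_disc [CompactSpace M] (hu : IsPencilPlane J u b) (hb : ‖b - G.b₀‖ < G.ρ')
    (hJstd : ∀ x : punctured p, InPuncturedChartBall p G.rad x →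
      ∀ (v : TangentSpace (𝓡 4) x) (c : EuclideanSpace ℝ (Fin 4)),
        inner ℝ (fderiv ℝ inversion (extChartAt (𝓡 4) p x.1 - extChartAt (𝓡 4) p p)
          (mfderiv (𝓡 4) 𝓘(ℝ, EuclideanSpace ℝ (Fin 4))
            (fun z : punctured p => extChartAt (𝓡 4) p z.1) x (J x v))) c
        = stdSymplecticForm (fderiv ℝ inversion (extChartAt (𝓡 4) p x.1 - extChartAt (𝓡 4) p p)
          (mfderiv (𝓡 4) 𝓘(ℝ, EuclideanSpace ℝ (Fin 4))
            (fun z : punctured p => extChartAt (𝓡 4) p z.1) x v)) c) :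
    ∃ r : ℝ, 0 < r ∧ DifferentiableOn ℂ (memberXW p u b) (ball 0 r) ∧
      MapsTo (memberXW p u b) (ball 0 r) G.box ∧
      ∀ η ∈ ball (0 : ℂ) r, G.memberV u b η = G.inBox (memberXW p u b η) := by
  obtain ⟨r₁, hr₁, hdiff⟩ := hu.exists_differentiableOn_memberXW G.rad_pos hJstd
  have hcont : ContinuousAt (memberXW p u b) 0 :=
    (hdiff.differentiableAt (ball_mem_nhds 0 hr₁)).continuousAt
  have hbox : ∀ᶠ η in 𝓝 (0 : ℂ), memberXW p u b η ∈ G.box := by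
    refine hcont.preimage_mem_nhds (G.box.isOpen.mem_nhds ?_)
    rw [memberXW_zero]; exact G.zero_intercept_mem_box hb
  obtain ⟨r₂, hr₂, h₂⟩ := Metric.eventually_nhds_iff_ball.1 (hbox.and (G.memberV_eventuallyEq hu hb))
  refine ⟨min r₁ r₂, lt_min hr₁ hr₂, hdiff.mono (ball_subset_ball (min_le_left _ _)),
    fun η hη => (h₂ η (ball_subset_ball (min_le_right _ _) hη)).1,
    fun η hη => (h₂ η (ball_subset_ball (min_le_right _ _) hη)).2⟩

/-- **The chart at infinity of the compactified member is `C^∞`.**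
[cite: Wendl2018, proof of Prop. 2.53 (p. 65)] -/
theorem contMDiff_memberV [CompactSpace M] (hu : IsPencilPlane J u b) (hb : ‖b - G.b₀‖ < G.ρ')
    (hJstd : ∀ x : punctured p, InPuncturedChartBall p G.rad x →
      ∀ (v : TangentSpace (𝓡 4) x) (c : EuclideanSpace ℝ (Fin 4)),
        inner ℝ (fderiv ℝ inversion (extChartAt (𝓡 4) p x.1 - extChartAt (𝓡 4) p p)
          (mfderiv (𝓡 4) 𝓘(ℝ, EuclideanSpace ℝ (Fin 4))
            (fun z : punctured p => extChartAt (𝓡 4) p z.1) x (J x v))) c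
        = stdSymplecticForm (fderiv ℝ inversion (extChartAt (𝓡 4) p x.1 - extChartAt (𝓡 4) p p)
          (mfderiv (𝓡 4) 𝓘(ℝ, EuclideanSpace ℝ (Fin 4))
            (fun z : punctured p => extChartAt (𝓡 4) p z.1) x v)) c) :
    ContMDiff 𝓘(ℝ, ℂ) (𝓡 4) ∞ (G.memberV u b) := by
  obtain ⟨r, hr, hdiff, hmaps, heq⟩ := G.exists_memberXW_disc hu hb hJstd
  have hsmooth : ContDiffOn ℝ ∞ (memberXW p u b) (ball 0 r) :=
    ((hdiff.analyticOnNhd isOpen_ball).contDiffOn isOpen_ball.uniqueDiffOn).restrict_scalars ℝ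
  have hV : ContMDiffOn 𝓘(ℝ, ℂ) (𝓡 4) ∞ (G.memberV u b) (ball 0 r) :=
    (G.contMDiffOn_inBox_comp hsmooth hmaps).congr heq
  intro η
  by_cases hη : ‖η‖ < r
  · exact hV.contMDiffAt (isOpen_ball.mem_nhds (by simpa using hη))
  · have hη0 : η ≠ 0 := by
      rintro rfl; exact hη (by simpa using hr)
    exact (G.contMDiffAt_inP_comp_inv hu.contMDiff hη0).congr_of_eventuallyEq
      (G.memberV_eventuallyEq_of_ne_zero hη0)

/-- **Derivative of the `ℂ`-chart**: `d(inP ∘ u) = du` (`d inP = id` in the preferred charts).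
[folklore] -/
theorem hasMFDerivAt_memberU {ξ : ℂ} (hu : MDifferentiableAt 𝓘(ℝ, ℂ) (𝓡 4) u ξ) :
    HasMFDerivAt 𝓘(ℝ, ℂ) (𝓡 4) (G.memberU u) ξ (mfderiv 𝓘(ℝ, ℂ) (𝓡 4) u ξ) :=
  ((G.hasMFDerivAt_inP (u ξ)).comp ξ hu.hasMFDerivAt).congr_mfderiv
    (ContinuousLinearMap.ext fun _ => rfl)

/-- **The `ℂ`-chart is `JY`-holomorphic** (`JY = J` on `M ∖ p`). [folklore] -/
theorem isJHolomorphic_memberU (hu : IsPencilPlane J u b) :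
    IsJHolomorphic (𝓡 4) (fun y => G.JY J y) (G.memberU u) := by
  intro ξ ζ
  rw [(G.hasMFDerivAt_memberU (hu.mdifferentiableAt ξ)).mfderiv]
  calc mfderiv 𝓘(ℝ, ℂ) (𝓡 4) u ξ (Complex.I * ζ)
      = J (u ξ) (mfderiv 𝓘(ℝ, ℂ) (𝓡 4) u ξ ζ) := hu.isJHolomorphic ξ ζ
    _ = G.JY J (G.inP (u ξ)) (mfderiv 𝓘(ℝ, ℂ) (𝓡 4) u ξ ζ) := by rw [G.JY_inP]; rfl
    _ = _ := rfl

/-- The `ℂ`-chart is injective. [folklore] -/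
theorem injective_memberU (hu : Injective u) : Injective (G.memberU u) :=
  G.glueData.inl_injective.comp hu

/-- The `ℂ`-chart is immersed. [folklore] -/
theorem injective_mfderiv_memberU (hu : IsPencilPlane J u b) (ξ : ℂ) :
    Injective (mfderiv 𝓘(ℝ, ℂ) (𝓡 4) (G.memberU u) ξ) := by
  rw [(G.hasMFDerivAt_memberU (hu.mdifferentiableAt ξ)).mfderiv]
  exact hu.injective_mfderiv ξ

/-- **Derivative of the chart at infinity off `0`**: `dV(η) = du(η⁻¹) ∘ (ζ ↦ -ζ/η²)`.
[folklore] -/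
theorem hasMFDerivAt_memberV_of_ne_zero (hu : IsPencilPlane J u b) {η : ℂ} (hη : η ≠ 0) :
    HasMFDerivAt 𝓘(ℝ, ℂ) (𝓡 4) (G.memberV u b) η
      ((mfderiv 𝓘(ℝ, ℂ) (𝓡 4) u η⁻¹).comp (invDeriv η)) := by
  have h1 : HasMFDerivAt 𝓘(ℝ, ℂ) (𝓡 4) (fun η' => G.inP (u η'⁻¹)) η
      ((mfderiv 𝓘(ℝ, ℂ) (𝓡 4) u η⁻¹).comp (invDeriv η)) :=
    (G.hasMFDerivAt_memberU (hu.mdifferentiableAt η⁻¹)).comp η (hasMFDerivAt_inv' hη)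
  exact h1.congr_of_eventuallyEq (G.memberV_eventuallyEq_of_ne_zero hη)

/-- **Derivative of the chart at infinity at `0`**: `dV(0) = flatCx⁻¹ ∘ memberXWDeriv`.
[cite: Wendl2018, proof of Prop. 2.53 (p. 65)] -/
theorem hasMFDerivAt_memberV_zero [CompactSpace M] (hu : IsPencilPlane J u b) (hb : ‖b - G.b₀‖ < G.ρ')
    (hJstd : ∀ x : punctured p, InPuncturedChartBall p G.rad x →
      ∀ (v : TangentSpace (𝓡 4) x) (c : EuclideanSpace ℝ (Fin 4)),
        inner ℝ (fderiv ℝ inversion (extChartAt (𝓡 4) p x.1 - extChartAt (𝓡 4) p p)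
          (mfderiv (𝓡 4) 𝓘(ℝ, EuclideanSpace ℝ (Fin 4))
            (fun z : punctured p => extChartAt (𝓡 4) p z.1) x (J x v))) c
        = stdSymplecticForm (fderiv ℝ inversion (extChartAt (𝓡 4) p x.1 - extChartAt (𝓡 4) p p)
          (mfderiv (𝓡 4) 𝓘(ℝ, EuclideanSpace ℝ (Fin 4))
            (fun z : punctured p => extChartAt (𝓡 4) p z.1) x v)) c) :
    HasMFDerivAt 𝓘(ℝ, ℂ) (𝓡 4) (G.memberV u b) 0
      ((flatCx.symm : ℂ × ℂ →L[ℝ] EuclideanSpace ℝ (Fin 4)).comp (memberXWDeriv u b)) := by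
  obtain ⟨r, hr, hdiff, hmaps, -⟩ := G.exists_memberXW_disc hu hb hJstd
  have h1 := G.hasMFDerivAt_inBox_comp (hu.hasFDerivAt_memberXW hr hdiff)
    (hmaps (mem_ball_self hr)) (by simp)
  exact h1.congr_of_eventuallyEq (G.memberV_eventuallyEq hu hb)

/-- **The chart at infinity is `JY`-holomorphic** (off `0`: `J`-holomorphy of `u` and complex
linearity of `d(η⁻¹)`; at `0`: `JY = i` in the box chart and complex linearity of the derivative of
the box coordinates). [cite: Wendl2018, proof of Prop. 2.53 (p. 65)] -/
theorem isJHolomorphic_memberV [CompactSpace M] (hu : IsPencilPlane J u b) (hb : ‖b - G.b₀‖ < G.ρ')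
    (hJstd : ∀ x : punctured p, InPuncturedChartBall p G.rad x →
      ∀ (v : TangentSpace (𝓡 4) x) (c : EuclideanSpace ℝ (Fin 4)),
        inner ℝ (fderiv ℝ inversion (extChartAt (𝓡 4) p x.1 - extChartAt (𝓡 4) p p)
          (mfderiv (𝓡 4) 𝓘(ℝ, EuclideanSpace ℝ (Fin 4))
            (fun z : punctured p => extChartAt (𝓡 4) p z.1) x (J x v))) c
        = stdSymplecticForm (fderiv ℝ inversion (extChartAt (𝓡 4) p x.1 - extChartAt (𝓡 4) p p)
          (mfderiv (𝓡 4) 𝓘(ℝ, EuclideanSpace ℝ (Fin 4))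
            (fun z : punctured p => extChartAt (𝓡 4) p z.1) x v)) c) :
    IsJHolomorphic (𝓡 4) (fun y => G.JY J y) (G.memberV u b) := by
  intro η ζ
  rcases eq_or_ne η 0 with rfl | hη
  · rw [(G.hasMFDerivAt_memberV_zero hu hb hJstd).mfderiv]
    have hJ0 : G.JY J (G.memberV u b 0) = flatI := by
      rw [memberV_zero, G.inBox_of_mem (G.zero_intercept_mem_box hb), G.JY_inB J rfl]
    calc ((flatCx.symm : ℂ × ℂ →L[ℝ] EuclideanSpace ℝ (Fin 4)).comp (memberXWDeriv u b))
          (Complex.I * ζ)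
        = flatCx.symm (memberXWDeriv u b (Complex.I • ζ)) := rfl
      _ = flatI (flatCx.symm (memberXWDeriv u b ζ)) := by
          rw [memberXWDeriv_smul, flatI_flatCx_symm]
      _ = G.JY J (G.memberV u b 0) (flatCx.symm (memberXWDeriv u b ζ)) := by rw [hJ0]
      _ = _ := rfl
  · rw [(G.hasMFDerivAt_memberV_of_ne_zero hu hη).mfderiv]
    have hJη : G.JY J (G.memberV u b η) = J (u η⁻¹) := by
      rw [G.memberV_of_ne_zero hη, G.JY_inP]
    calc ((mfderiv 𝓘(ℝ, ℂ) (𝓡 4) u η⁻¹).comp (invDeriv η)) (Complex.I * ζ)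
        = mfderiv 𝓘(ℝ, ℂ) (𝓡 4) u η⁻¹ (invDeriv η (Complex.I * ζ)) := rfl
      _ = mfderiv 𝓘(ℝ, ℂ) (𝓡 4) u η⁻¹ (Complex.I * invDeriv η ζ) := by rw [invDeriv_I_mul]
      _ = J (u η⁻¹) (mfderiv 𝓘(ℝ, ℂ) (𝓡 4) u η⁻¹ (invDeriv η ζ)) := hu.isJHolomorphic _ _
      _ = G.JY J (G.memberV u b η) (mfderiv 𝓘(ℝ, ℂ) (𝓡 4) u η⁻¹ (invDeriv η ζ)) := by
          rw [hJη]; rfl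
      _ = _ := rfl

/-- **The chart at infinity is immersed** (at `0`: `X'(0) = 1`). [cite: Wendl2018, Prop. 2.53 (p. 65)] -/
theorem injective_mfderiv_memberV [CompactSpace M] (hu : IsPencilPlane J u b) (hb : ‖b - G.b₀‖ < G.ρ')
    (hJstd : ∀ x : punctured p, InPuncturedChartBall p G.rad x →
      ∀ (v : TangentSpace (𝓡 4) x) (c : EuclideanSpace ℝ (Fin 4)),
        inner ℝ (fderiv ℝ inversion (extChartAt (𝓡 4) p x.1 - extChartAt (𝓡 4) p p)
          (mfderiv (𝓡 4) 𝓘(ℝ, EuclideanSpace ℝ (Fin 4))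
            (fun z : punctured p => extChartAt (𝓡 4) p z.1) x (J x v))) c
        = stdSymplecticForm (fderiv ℝ inversion (extChartAt (𝓡 4) p x.1 - extChartAt (𝓡 4) p p)
          (mfderiv (𝓡 4) 𝓘(ℝ, EuclideanSpace ℝ (Fin 4))
            (fun z : punctured p => extChartAt (𝓡 4) p z.1) x v)) c) (η : ℂ) :
    Injective (mfderiv 𝓘(ℝ, ℂ) (𝓡 4) (G.memberV u b) η) := by
  rcases eq_or_ne η 0 with rfl | hη
  · rw [(G.hasMFDerivAt_memberV_zero hu hb hJstd).mfderiv]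
    exact flatCx.symm.injective.comp injective_memberXWDeriv
  · rw [(G.hasMFDerivAt_memberV_of_ne_zero hu hη).mfderiv]
    exact (hu.injective_mfderiv η⁻¹).comp (injective_invDeriv hη)

end Member

end PencilEnd

end Literature.Geometry.Symplectic
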